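import Mathlib
import HarnessLib
import Literature.NumberTheory.Transcendental.KZCalculus
import Literature.NumberTheory.Transcendental.KZGroundingRelations
import Literature.NumberTheory.Transcendental.SemialgebraicMapsProofs
import Summits.KontsevichZagierPeriods.KontsevichZagierPeriods.Theses.LinRedNormalForm
import Summits.KontsevichZagierPeriods.KontsevichZagierPeriods.Theorems.MzvKernelInKZTwoPosetsCubicalChart
import Summits.KontsevichZagierPeriods.KontsevichZagierPeriods.Theorems.LinRedNormalFormDihedralNormalFormStubAtomReductionAux4
import Summits.KontsevichZagierPeriods.KontsevichZagierPeriods.Theorems.LinRedNormalFormDihedralNormalFormStubAtomReductionAux5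

/-!
# Stub `stub_atomReduction` of the line `torus-descent-sum-shadow` (crux `DihedralNormalForm`)

ENTRANCE of the line: an absolutely convergent genus-zero representation
`[Δ_k, P(t) / (∏ tᵢ^{bᵢ} ∏ (1 - tᵢ)^{cᵢ} ∏_{i<j} (tᵢ - tⱼ)^{aᵢⱼ})]` on the open ordered simplex is
congruent modulo `KZ.relations` to a `ℤ`-combination of CONVERGENT cubical atoms
`[(0,1)ᵏ, q · ∏ xᵢ^{aᵢ} · ∏_{i ≤ j} (1 - xᵢ ⋯ xⱼ)^{e i j}]` (`a ∈ ℕᵏ`, `e ∈ ℤ`, each an absolutely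
integrable `KZ.IntegralRep`).

Chain of the proof (`atomReduction_succ`): the cubical chart `tᵢ = x₀ ⋯ xᵢ` (ONE rule-2 move,
tools V) gives `[(0,1)ᵏ, N · M · K]`; monomial content `N = x^m Ñ` and FACES (`d ≥ 0`, tools V) put
the integrand in the shape `Ñ(x) · ATOM⟪k, a, e₀, x⟫`; the Taylor expansion `Ñ = ∑ c_ν (1 - x)^ν`
at the corner `x = 1` writes it as `∑ c_ν · ATOM⟪k, a, e₀ + DIAG⟪ν⟫, x⟫`, where EVERY term is
absolutely integrable by the domination lemma (tools IV, `integrableOn_atomFun_add_diag`); the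
atoms are `ℚ`-semialgebraic (`isSemialgebraicFunOn_atomFun`: quotients of `ℚ`-polynomials), and
iterated integrand additivity (`KZ.of_sub_sum_integrand_mem_relations`, rule 1b) concludes.
Dimension `0` is the trivial `atomReduction_zero`.

Recurring terms are written through parse-time notations (`CP⟪⟫`, `ATOM⟪⟫`, `SEC⟪⟫`, `NC⟪⟫`,
`CHORD⟪⟫`, `WEIGHT⟪⟫`, `EXPL⟪⟫`, `CPOLY⟪⟫`, `DIAG⟪⟫`, …); the files introduce no definitions.
-/

noncomputable section

open MeasureTheory Set MvPolynomial Filter Topology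

namespace Summit.KontsevichZagierPeriods.DihedralNormalForm.TorusDescent

namespace AtomReduction

open Summit.KontsevichZagierPeriods.MzvKernelInKZ
open Summit.KontsevichZagierPeriods.FurushoPentagon.HoffmanRelationInKZ
  (hasFDerivAt_monomialChart det_monomialChart)
open Literature.NumberTheory.Transcendental
open Literature.ModelTheory.ExponentialFields (IsSemialgebraic)

variable {k : ℕ}

/-! ### Notation (parse-time abbreviations; no definitions are introduced) -/

set_option quotPrecheck false

local notation "CP⟪" k ", " i ", " j ", " x "⟫" =>
  (∏ l : Fin k, if i ≤ l ∧ l ≤ j then x l else (1:ℝ))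
local notation "ATOM⟪" k ", " a ", " e ", " x "⟫" =>
  ((∏ i : Fin k, x i ^ (a i : ℕ)) *
    ∏ i : Fin k, ∏ j : Fin k, if i ≤ j then (1 - CP⟪k, i, j, x⟫) ^ (e i j : ℤ) else (1:ℝ))
local notation "SEC⟪" k ", " π "⟫" =>
  ({v : Fin k → ℝ | (∀ i, v i ∈ Set.Ioo (0:ℝ) 1) ∧ StrictAnti fun j => v (π j)} : Set (Fin k → ℝ))
local notation "NC⟪" k ", " π ", " y "⟫" =>
  (Summit.KontsevichZagierPeriods.MzvKernelInKZ.TwoPosets.cubicalMap k y ∘ (Equiv.symm π))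
local notation "CHORD⟪" I ", " v "⟫" => ((1:ℝ) - ∏ l ∈ I, (1 - v l))
local notation "WEIGHT⟪" I ", " γ ", " d ", " v "⟫" =>
  ((∏ l, (1 - v l) ^ (d l : ℕ)) * ∏ a, CHORD⟪I a, v⟫ ^ (γ a : ℤ))
local notation "DIAG⟪" ν "⟫" => (fun i j => if i = j then ((ν i : ℕ) : ℤ) else 0)
local notation "CPP⟪" k ", " i ", " j "⟫" =>
  (∏ l : Fin k, if i ≤ l ∧ l ≤ j then (MvPolynomial.X l : MvPolynomial (Fin k) ℚ) else 1)
local notation "ANUM⟪" k ", " q ", " a ", " e "⟫" =>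
  (MvPolynomial.C (q : ℚ) * (∏ i : Fin k, (MvPolynomial.X i : MvPolynomial (Fin k) ℚ) ^ (a i : ℕ)) *
    ∏ i : Fin k, ∏ j : Fin k, if i ≤ j then (1 - CPP⟪k, i, j⟫) ^ (e i j : ℤ).toNat else 1)
local notation "ADEN⟪" k ", " e "⟫" =>
  (∏ i : Fin k, ∏ j : Fin k, if i ≤ j then (1 - CPP⟪k, i, j⟫) ^ (-(e i j : ℤ)).toNat else 1)

set_option quotPrecheck true

/-- The open cube of this line is `ℚ`-semialgebraic. -/
theorem isSemialgebraic_cube_Ioo (k : ℕ) :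
    IsSemialgebraic ℚ {x : Fin k → ℝ | ∀ i, x i ∈ Ioo (0:ℝ) 1} :=
  TwoPosets.isSemialgebraic_cube k

/-! ### Semialgebraicity: the atom kernel is a quotient of polynomials -/

/-- Evaluating `cpPoly` gives `cp`. -/
theorem aeval_cpPoly (i j : Fin k) (x : Fin k → ℝ) : aeval x (CPP⟪k, i, j⟫) = CP⟪k, i, j, x⟫ := by
  rw [map_prod]
  refine Finset.prod_congr rfl fun l _ => ?_
  split_ifs <;> simp

/-- An integer power is the quotient of the powers by the positive and negative parts. -/
theorem zpow_eq_pow_div_pow {z : ℝ} (hz : z ≠ 0) (e : ℤ) :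
    z ^ e = z ^ e.toNat / z ^ (-e).toNat := by
  conv_lhs => rw [← Int.toNat_sub_toNat_neg e]
  rw [zpow_sub₀ hz, zpow_natCast, zpow_natCast]

/-- The denominator does not vanish on the open cube. -/
theorem aeval_atomDen_ne_zero (e : Fin k → Fin k → ℤ) {x : Fin k → ℝ}
    (hx : ∀ i, x i ∈ Ioo (0:ℝ) 1) : aeval x (ADEN⟪k, e⟫) ≠ 0 := by
  simp only [map_prod]
  refine Finset.prod_ne_zero_iff.2 fun i _ => Finset.prod_ne_zero_iff.2 fun j _ => ?_
  split_ifs with h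
  · rw [map_pow, map_sub, map_one, aeval_cpPoly]
    exact pow_ne_zero _ (one_sub_cp_pos h hx).ne'
  · rw [map_one]; exact one_ne_zero

/-- On the open cube, `q · atomFun a e = atomNum / atomDen`. -/
theorem const_mul_atomFun_eq_div (q : ℚ) (a : Fin k → ℕ) (e : Fin k → Fin k → ℤ) {x : Fin k → ℝ}
    (hx : ∀ i, x i ∈ Ioo (0:ℝ) 1) :
    (q : ℝ) * ATOM⟪k, a, e, x⟫ = aeval x (ANUM⟪k, q, a, e⟫) / aeval x (ADEN⟪k, e⟫) := by
  have hnum : aeval x (ANUM⟪k, q, a, e⟫) = (q : ℝ) * (∏ i, x i ^ a i) *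
      ∏ i, ∏ j, if i ≤ j then (1 - CP⟪k, i, j, x⟫) ^ (e i j).toNat else 1 := by
    simp only [map_mul, map_prod, map_pow, aeval_X, aeval_C, eq_ratCast]
    congr 1
    refine Finset.prod_congr rfl fun i _ => Finset.prod_congr rfl fun j _ => ?_
    split_ifs
    · rw [map_pow, map_sub, map_one, aeval_cpPoly]
    · rw [map_one]
  have hden : aeval x (ADEN⟪k, e⟫) =
      ∏ i, ∏ j, if i ≤ j then (1 - CP⟪k, i, j, x⟫) ^ (-e i j).toNat else 1 := by
    simp only [map_prod]
    refine Finset.prod_congr rfl fun i _ => Finset.prod_congr rfl fun j _ => ?_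
    split_ifs
    · rw [map_pow, map_sub, map_one, aeval_cpPoly]
    · rw [map_one]
  have hsplit : (∏ i, ∏ j, if i ≤ j then (1 - CP⟪k, i, j, x⟫) ^ e i j else (1:ℝ)) =
      (∏ i, ∏ j, if i ≤ j then (1 - CP⟪k, i, j, x⟫) ^ (e i j).toNat else (1:ℝ)) /
        ∏ i, ∏ j, if i ≤ j then (1 - CP⟪k, i, j, x⟫) ^ (-e i j).toNat else 1 := by
    rw [← Finset.prod_div_distrib]
    refine Finset.prod_congr rfl fun i _ => ?_
    rw [← Finset.prod_div_distrib]
    refine Finset.prod_congr rfl fun j _ => ?_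
    split_ifs with h
    · exact zpow_eq_pow_div_pow (one_sub_cp_pos h hx).ne' _
    · simp
  rw [hnum, hden, hsplit]
  ring

/-- `q · atomFun a e` is a `ℚ`-semialgebraic function on the open cube. -/
theorem isSemialgebraicFunOn_atomFun (q : ℚ) (a : Fin k → ℕ) (e : Fin k → Fin k → ℤ) :
    IsSemialgebraicFunOn ℚ {x : Fin k → ℝ | ∀ i, x i ∈ Ioo (0:ℝ) 1}
      (fun x => (q : ℝ) * ATOM⟪k, a, e, x⟫) :=
  (isSemialgebraicFunOn_aeval_div_aeval (isSemialgebraic_cube_Ioo k) (ANUM⟪k, q, a, e⟫)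
    (ADEN⟪k, e⟫) fun _ hx => aeval_atomDen_ne_zero e hx).congr
    fun _ hx => (const_mul_atomFun_eq_div q a e hx).symm

/-- **The atom representation** `[(0,1)ᵏ, q · atomFun a e]` attached to an absolutely integrable
atom kernel. -/
theorem exists_atomRep (q : ℚ) (a : Fin k → ℕ) (e : Fin k → Fin k → ℤ)
    (hint : IntegrableOn (fun x => ATOM⟪k, a, e, x⟫) {x : Fin k → ℝ | ∀ i, x i ∈ Ioo (0:ℝ) 1}) :
    ∃ s : KZ.IntegralRep k, s.domain = {x : Fin k → ℝ | ∀ i, x i ∈ Ioo (0:ℝ) 1} ∧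
      s.integrand = fun x => (q : ℝ) * ATOM⟪k, a, e, x⟫ :=
  ⟨{ domain := {x : Fin k → ℝ | ∀ i, x i ∈ Ioo (0:ℝ) 1}
     integrand := fun x => (q : ℝ) * ATOM⟪k, a, e, x⟫
     isSemialgebraic_domain := isSemialgebraic_cube_Ioo k
     isSemialgebraicFunOn_integrand := isSemialgebraicFunOn_atomFun q a e
     integrableOn := hint.const_mul _ }, rfl, rfl⟩

/-! ### The domination lemma in atom coordinates -/

section XForm

variable {k : ℕ}

/-- **Domination lemma, atom form.** If `P(1 - x) · atomFun a e x` is absolutely integrable on the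
open cube, then so is the atom kernel `atomFun a (e + DIAG⟪ν⟫)` (= `∏ (1 - xᵢ)^{νᵢ} · atomFun a e`)
for every monomial `v^ν` of `P`. -/
theorem integrableOn_atomFun_add_diag (a : Fin k → ℕ) (e : Fin k → Fin k → ℤ)
    (P : MvPolynomial (Fin k) ℝ)
    (h : IntegrableOn (fun x => eval (fun i => 1 - x i) P * ATOM⟪k, a, e, x⟫)
      {x : Fin k → ℝ | ∀ i, x i ∈ Ioo (0:ℝ) 1}) :
    ∀ ν ∈ P.support, IntegrableOn ((fun x => ATOM⟪k, a, (e + DIAG⟪ν⟫), x⟫))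
      {x : Fin k → ℝ | ∀ i, x i ∈ Ioo (0:ℝ) 1} := by
  classical
  intro ν hν
  set I : Fin k × Fin k → Finset (Fin k) := fun q =>
    if q.1 ≤ q.2 then Finset.Icc q.1 q.2 else {q.1} with hI_def
  set γ : Fin k × Fin k → ℤ := fun q => if q.1 ≤ q.2 then e q.1 q.2 else 0 with hγ_def
  have hI : ∀ q, (I q).Nonempty := fun q => by
    simp only [hI_def]
    split_ifs with hq
    · exact Finset.nonempty_Icc.2 hq
    · exact Finset.singleton_nonempty _
  have hfun : ∀ v : Fin k → ℝ, ATOM⟪k, a, e, (fun i => 1 - v i)⟫ = WEIGHT⟪I, γ, a, v⟫ := by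
    intro v
    congr 1
    rw [Fintype.prod_prod_type]
    refine Finset.prod_congr rfl fun i _ => Finset.prod_congr rfl fun j _ => ?_
    simp only [hI_def, hγ_def]
    split_ifs with hij
    · have hset : Finset.univ.filter (fun l : Fin k => i ≤ l ∧ l ≤ j) = Finset.Icc i j := by
        ext l; simp
      rw [← hset, Finset.prod_filter]
    · simp
  have h1 : IntegrableOn (fun v => eval v P * WEIGHT⟪I, γ, a, v⟫) {x : Fin k → ℝ | ∀ i, x i ∈ Ioo (0:ℝ) 1} := by
    have := (integrableOn_cube_comp_one_sub_iff
      (fun x => eval (fun i => 1 - x i) P * ATOM⟪k, a, e, x⟫)).2 h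
    refine this.congr_fun (fun v _ => ?_) (measurableSet_cube k)
    simp only [sub_sub_cancel, hfun]
  have h2 := integrableOn_monomial_mul_weightV I hI γ a P h1 ν hν
  rw [← integrableOn_cube_comp_one_sub_iff]
  refine h2.congr_fun (fun v hv => ?_) (measurableSet_cube k)
  have hv' : ∀ i, (fun i => 1 - v i) i ∈ Ioo (0:ℝ) 1 := fun i =>
    ⟨by simp only; linarith [(hv i).2], by simp only; linarith [(hv i).1]⟩
  rw [atomFun_add_diag a e ν hv', hfun]
  simp

end XForm

/-! ### Dimension zero -/

section Zero

/-- In dimension `0` the representation is itself an atom (a rational constant on the point). -/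
theorem atomReduction_zero (r : KZ.IntegralRep 0) (p : MvPolynomial (Fin 0) ℚ)
    (a : Fin 0 → Fin 0 → ℕ) (b c : Fin 0 → ℕ)
    (hdom : r.domain = {t | (∀ i, 0 < t i) ∧ (∀ i, t i < 1) ∧ StrictAnti t})
    (hint : Set.EqOn r.integrand (fun t => MvPolynomial.aeval t p / ((∏ i, t i ^ b i) *
      (∏ i, (1 - t i) ^ c i) * ∏ i, ∏ j, if i < j then (t i - t j) ^ a i j else 1)) r.domain) :
    ∃ m ∈ AddSubgroup.closure {z : KZ.FormalRep | ∃ (q : ℚ) (a : Fin 0 → ℕ) (e : Fin 0 → Fin 0 → ℤ)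
      (s : KZ.IntegralRep 0), s.domain = {x : Fin 0 → ℝ | ∀ i, x i ∈ Set.Ioo (0:ℝ) 1} ∧
      Set.EqOn s.integrand (fun x => (q : ℝ) * ((∏ i : Fin 0, x i ^ a i) * ∏ i : Fin 0, ∏ j : Fin 0,
        if i ≤ j then (1 - (∏ l : Fin 0, if i ≤ l ∧ l ≤ j then x l else 1)) ^ e i j else 1))
        s.domain ∧ z = KZ.of s}, KZ.of r - m ∈ KZ.relations := by
  refine ⟨KZ.of r, AddSubgroup.subset_closure ⟨p.coeff 0, fun _ => 0, fun _ _ => 0, r, ?_, ?_, rfl⟩,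
    by simp⟩
  · rw [hdom]
    ext t
    simp only [mem_setOf_eq, IsEmpty.forall_iff, true_and]
    exact ⟨fun _ => trivial, fun _ => fun i => i.elim0⟩
  · intro t ht
    rw [hint ht]
    simp only [Finset.univ_eq_empty, Finset.prod_empty, mul_one, div_one]
    rw [MvPolynomial.eq_C_of_isEmpty p, aeval_C, coeff_C, if_pos rfl]
    simp

end Zero

/-! ### The stub -/

section Main

variable {n : ℕ}

/-- **Atom reduction in positive dimension** (the assembly): chart, pull-back shape, content,
faces, Taylor expansion at `x = 1`, termwise convergence by the domination lemma, and iterated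
integrand additivity. -/
theorem atomReduction_succ (r : KZ.IntegralRep (n + 1)) (p : MvPolynomial (Fin (n + 1)) ℚ)
    (a : Fin (n + 1) → Fin (n + 1) → ℕ) (b c : Fin (n + 1) → ℕ)
    (hdom : r.domain = {t | (∀ i, 0 < t i) ∧ (∀ i, t i < 1) ∧ StrictAnti t})
    (hint : Set.EqOn r.integrand (fun t => MvPolynomial.aeval t p / ((∏ i, t i ^ b i) *
      (∏ i, (1 - t i) ^ c i) * ∏ i, ∏ j, if i < j then (t i - t j) ^ a i j else 1)) r.domain) :
    ∃ m ∈ AddSubgroup.closure {z : KZ.FormalRep | ∃ (q : ℚ) (a : Fin (n + 1) → ℕ)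
      (e : Fin (n + 1) → Fin (n + 1) → ℤ) (s : KZ.IntegralRep (n + 1)),
      s.domain = {x : Fin (n + 1) → ℝ | ∀ i, x i ∈ Set.Ioo (0:ℝ) 1} ∧
      Set.EqOn s.integrand (fun x => (q : ℝ) * ((∏ i : Fin (n + 1), x i ^ a i) *
        ∏ i : Fin (n + 1), ∏ j : Fin (n + 1), if i ≤ j then
          (1 - (∏ l : Fin (n + 1), if i ≤ l ∧ l ≤ j then x l else 1)) ^ e i j else 1)) s.domain ∧
      z = KZ.of s}, KZ.of r - m ∈ KZ.relations := by
  classical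
  -- Step 1: the chart
  obtain ⟨r₁, hr₁d, hr₁i, hrel₁⟩ := exists_cube_rep_of_simplex_rep r _ hdom hint
  -- Step 2: the pull-back shape
  obtain ⟨M, K, ⟨d₀, hd₀⟩, ⟨e₀, he₀⟩, hshape⟩ := pullback_shape p a b c
  set N : MvPolynomial (Fin (n + 1)) ℚ :=
    bind₁ (fun i => ∏ l ∈ Finset.univ.filter (fun l => l ≤ i), X l) p with hN
  have hg : ∀ x : Fin (n + 1) → ℝ, (∀ i, x i ∈ Ioo (0:ℝ) 1) →
      r₁.integrand x = MvPolynomial.aeval x N * M x * K x := by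
    intro x hx
    rw [hr₁i]
    simp only
    rw [abs_jacobian_eq hx]
    exact hshape x hx
  -- Step 3: the zero polynomial
  by_cases hN0 : N = 0
  · refine ⟨0, zero_mem _, ?_⟩
    rw [sub_zero]
    have h0 : KZ.of r₁ ∈ KZ.relations :=
      KZ.of_mem_relations_of_eqOn_zero r₁ fun x hx => by
        rw [hr₁d] at hx
        rw [hg x hx, hN0]
        simp
    have := add_mem hrel₁ h0
    rwa [sub_add_cancel] at this
  -- Step 4: content and faces
  obtain ⟨m, Nt, hNm, hc⟩ := exists_content N hN0
  obtain ⟨d, hd⟩ : ∃ d : Fin (n + 1) → ℤ, ∀ l, d l = (m l : ℤ) + d₀ l := ⟨_, fun _ => rfl⟩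
  have hg2 : ∀ x : Fin (n + 1) → ℝ, (∀ i, x i ∈ Ioo (0:ℝ) 1) →
      r₁.integrand x = MvPolynomial.aeval x Nt * ((∏ l, x l ^ d l) *
        ∏ i, ∏ j, if i ≤ j then (1 - CP⟪(n + 1), i, j, x⟫) ^ e₀ i j else 1) := by
    intro x hx
    rw [hg x hx, hNm, aeval_monomial_mul, hd₀ x hx, he₀ x hx]
    have hmd : (∏ l, x l ^ m l) * ∏ l, x l ^ d₀ l = ∏ l, x l ^ d l := by
      rw [← Finset.prod_mul_distrib]
      refine Finset.prod_congr rfl fun l _ => ?_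
      rw [hd l, zpow_add₀ (hx l).1.ne', zpow_natCast]
    rw [← hmd]
    ring
  have hint₂ : IntegrableOn (fun x => MvPolynomial.aeval x Nt * ((∏ l, x l ^ d l) *
      ∏ i, ∏ j, if i ≤ j then (1 - CP⟪(n + 1), i, j, x⟫) ^ e₀ i j else 1))
      {x : Fin (n + 1) → ℝ | ∀ i, x i ∈ Ioo (0:ℝ) 1} := by
    have h := r₁.integrableOn
    rw [hr₁d] at h
    exact h.congr_fun (fun x hx => hg2 x hx) (measurableSet_cube (n + 1))
  have hdnn := exponent_nonneg Nt hc d e₀ hint₂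
  set acoef : Fin (n + 1) → ℕ := fun l => (d l).toNat with hacoef
  have hg3 : ∀ x : Fin (n + 1) → ℝ, (∀ i, x i ∈ Ioo (0:ℝ) 1) →
      r₁.integrand x = MvPolynomial.aeval x Nt * ATOM⟪(n + 1), acoef, e₀, x⟫ := by
    intro x hx
    rw [hg2 x hx]
    congr 2
    refine Finset.prod_congr rfl fun l _ => ?_
    rw [← zpow_natCast, hacoef]
    simp only
    rw [Int.toNat_of_nonneg (hdnn l)]
  -- Step 5: Taylor expansion at `x = 1`
  set Nt' : MvPolynomial (Fin (n + 1)) ℚ := bind₁ (fun i => (1 : MvPolynomial (Fin (n + 1)) ℚ) - X i) Nt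
    with hNt'
  set P : MvPolynomial (Fin (n + 1)) ℝ := MvPolynomial.map (algebraMap ℚ ℝ) Nt' with hP
  have hPs : P.support = Nt'.support := by
    rw [hP, support_map_of_injective _ (algebraMap ℚ ℝ).injective]
  have hPe : ∀ x : Fin (n + 1) → ℝ, eval (fun i => 1 - x i) P = MvPolynomial.aeval x Nt := by
    intro x
    rw [hP, eval_map, ← aeval_def, hNt', aeval_one_sub_bind₁]
  -- Step 6: termwise convergence
  have hPint : IntegrableOn (fun x => eval (fun i => 1 - x i) P * ATOM⟪(n + 1), acoef, e₀, x⟫)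
      {x : Fin (n + 1) → ℝ | ∀ i, x i ∈ Ioo (0:ℝ) 1} := by
    have h := r₁.integrableOn
    rw [hr₁d] at h
    exact h.congr_fun (fun x hx => by rw [hg3 x hx, hPe]) (measurableSet_cube (n + 1))
  have hatom : ∀ ν ∈ Nt'.support, IntegrableOn ((fun x => ATOM⟪(n + 1), acoef, (e₀ + DIAG⟪ν⟫), x⟫))
      {x : Fin (n + 1) → ℝ | ∀ i, x i ∈ Ioo (0:ℝ) 1} := fun ν hν =>
    integrableOn_atomFun_add_diag acoef e₀ P hPint ν (hPs ▸ hν)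
  -- Step 7: the atoms and the relation
  have hrep : ∀ ν (hν : ν ∈ Nt'.support), ∃ s : KZ.IntegralRep (n + 1),
      s.domain = {x : Fin (n + 1) → ℝ | ∀ i, x i ∈ Ioo (0:ℝ) 1} ∧
      s.integrand = fun x => ((Nt'.coeff ν : ℚ) : ℝ) * ATOM⟪(n + 1), acoef, (e₀ + DIAG⟪ν⟫), x⟫ :=
    fun ν hν => exists_atomRep (Nt'.coeff ν) acoef (e₀ + DIAG⟪ν⟫) (hatom ν hν)
  set s : (Fin (n + 1) →₀ ℕ) → KZ.IntegralRep (n + 1) := fun ν =>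
    if hν : ν ∈ Nt'.support then (hrep ν hν).choose else r₁ with hs
  have hsν : ∀ ν (hν : ν ∈ Nt'.support),
      (s ν).domain = {x : Fin (n + 1) → ℝ | ∀ i, x i ∈ Ioo (0:ℝ) 1} ∧
      (s ν).integrand = fun x => ((Nt'.coeff ν : ℚ) : ℝ) * ATOM⟪(n + 1), acoef, (e₀ + DIAG⟪ν⟫), x⟫ :=
    fun ν hν => by
      rw [hs]
      simp only [hν, dif_pos]
      exact (hrep ν hν).choose_spec
  refine ⟨∑ ν ∈ Nt'.support, KZ.of (s ν), ?_, ?_⟩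
  · refine AddSubgroup.sum_mem _ fun ν hν => AddSubgroup.subset_closure ?_
    refine ⟨Nt'.coeff ν, acoef, e₀ + DIAG⟪ν⟫, s ν, (hsν ν hν).1, ?_, rfl⟩
    rw [(hsν ν hν).2]
    intro x _
    rfl
  · have hsum : KZ.of r₁ - ∑ ν ∈ Nt'.support, KZ.of (s ν) ∈ KZ.relations := by
      refine KZ.of_sub_sum_integrand_mem_relations Nt'.support s r₁ (fun ν hν => ?_)
        (fun x hx => ?_)
      · rw [(hsν ν hν).1, hr₁d]
      · rw [hr₁d] at hx
        rw [hg3 x hx, aeval_taylor Nt x, Finset.sum_mul]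
        refine Finset.sum_congr rfl fun ν hν => ?_
        rw [(hsν ν hν).2]
        simp only
        rw [atomFun_add_diag acoef e₀ ν hx]
        ring
    have := add_mem hrel₁ hsum
    rwa [sub_add_sub_cancel] at this

end Main

end AtomReduction

open AtomReduction in
/-- **stub_atomReduction** (L). ENTRANCE of the line `torus-descent-sum-shadow`: the cubical chart
`tᵢ = x₀ x₁ ⋯ xᵢ` (rule 2, polynomial map, Jacobian `∏ xᵢ^{k-1-i}`) carries a genus-zero
representation on the open ordered simplex to the open cube, where the integrand is
`P(x)·x^{-B}·∏(1 - x_I)^{e_I}`; absolute convergence forces the expansion in `(x, 1 - x)` to be a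
`ℚ`-combination of CONVERGENT atoms (the elementary domination lemma
`integrableOn_monomial_mul_weightV` replaces Brown's Lemma 7.4), and iterated rule 1b finishes. -/
theorem stub_atomReduction : ∀ (k : ℕ) (r : Literature.NumberTheory.Transcendental.KZ.IntegralRep k) (p : MvPolynomial (Fin k) ℚ) (a : Fin k → Fin k → ℕ) (b c : Fin k → ℕ), r.domain = {t | (∀ i, 0 < t i) ∧ (∀ i, t i < 1) ∧ StrictAnti t} → Set.EqOn r.integrand (fun t => MvPolynomial.aeval t p / ((∏ i, t i ^ b i) * (∏ i, (1 - t i) ^ c i) * ∏ i, ∏ j, if i < j then (t i - t j) ^ a i j else 1)) r.domain → ∃ m ∈ AddSubgroup.closure {z : Literature.NumberTheory.Transcendental.KZ.FormalRep | ∃ (q : ℚ) (a : Fin k → ℕ) (e : Fin k → Fin k → ℤ) (s : Literature.NumberTheory.Transcendental.KZ.IntegralRep k), s.domain = {x : Fin k → ℝ | ∀ i, x i ∈ Set.Ioo (0:ℝ) 1} ∧ Set.EqOn s.integrand (fun x => (q : ℝ) * ((∏ i : Fin k, x i ^ a i) * ∏ i : Fin k, ∏ j : Fin k, if i ≤ j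 then (1 - (∏ l : Fin k, if i ≤ l ∧ l ≤ j then x l else 1)) ^ e i j else 1)) s.domain ∧ z = Literature.NumberTheory.Transcendental.KZ.of s}, Literature.NumberTheory.Transcendental.KZ.of r - m ∈ Literature.NumberTheory.Transcendental.KZ.relations := by
  intro k r p a b c hdom hint
  cases k with
  | zero => exact atomReduction_zero r p a b c hdom hint
  | succ n => exact atomReduction_succ r p a b c hdom hint

end Summit.KontsevichZagierPeriods.DihedralNormalForm.TorusDescent
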